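import Summits.BirchSwinnertonDyer.Rank1Residual.Supersingular.TamParityChi8
import Summits.BirchSwinnertonDyer.Rank1Residual.Supersingular.TamagawaParitySquare
import Literature.NumberTheory.EllipticCurves.SerreOpenImageOrdinaryInertiaProofs
import Literature.NumberTheory.EllipticCurves.QuadraticTwistTwoLFunctionProofs
import Literature.NumberTheory.EllipticCurves.QuadraticTwistKroneckerRootNumberProofs
import Literature.NumberTheory.EllipticCurves.Rank1Residual.Predicates
import HarnessLib

/-!
# `Tam(E)` odd and supersingular at `2` ⇒ `N_E ≡ ±3 (mod 8)`, `χ₈(N_E) = −1`, `w(E^{(2)}) = −w(E)` — in the tree's language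
# (cell `b2b-bsdres`, O1 sub-cell `p = 2`; lens-1 GEN 9 rider 9a LINK LEMMA ported + ASSEMBLY with packet C and (26a); cc-typer-4 GEN 6)

HONEST FRAMING (run/shared/lean/b2b/bsd-rank1-residual/, verbatim in every file): the goal of the cell is to DELETE
the COMBINATION-SHAPED residual classes of the Birch–Swinnerton-Dyer formula for ALL analytic-rank `≤ 1` elliptic
curves over `ℚ` — "full BSD formula for every rank `≤ 1` curve in class `C`" assembled STRICTLY from published
theorems — so that the rank-`≤ 1` remainder becomes exactly the CONSTRUCTION-SHAPED classes, which are TYPED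
(missing-input `Prop`s), NOT attempted. This is not "finishing BSD". Elementary THEOREMS with every hypothesis explicit
(no `def`, no named fact); nothing about a particular curve; nothing is booked, no RESIDUAL-MAP mark moves. PARITY
BOOKKEEPING AT 2 (o1 lead R-G21.3 (iv) γ, "hygiene of record"): on Tam-odd rows the sign of the `χ₈`-twist is
DETERMINED — no 2-adic line of the cell may treat `w₈` as a free parameter there.

§1 = the o1 lens-1 GEN 9 rider 9a packet `HOME/b2b-bsdres-o1-idea-1-g9/lean/G9_LinkLemmaSS2.lean`
(planner-b2b-bsdres-o1-idea-1-g9-0, 2026-08-21T15:20Z; refuter v12a §81 "9a LINK LEMMA: PASS, kernel-shaped"), ported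
VERBATIM up to: imports narrowed (`import Mathlib` dropped), the `LensOneG9` sub-namespace dropped (as for the G8 / G9
ports p279752 / p281169 / p285349 / p285534), and its private copies `Δ_eq_eight_mul_add_five'` / `Δ_emod_eight'` of
packet C replaced by the tree originals (`Supersingular/TamParityChi8.lean`, p285349) — one-writer rule (C159).
It closes the one hypothesis of packet C stated on coefficients (`Even a₁ ∧ Odd a₃`) rather than in the tree's language:
for a globally minimal `W / ℚ` with `W.HasGoodReductionAtPrime 2` and `2 ∣ W.frobeniusTrace 2` (= `GoodSS W 2` of
`Rank1Residual.Predicates`) the integral model has `a₁` even and `a₃` odd, hence `minimalDiscriminantInt W ≡ 5 (mod 8)`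
("2 is inert in `ℚ(√Δ)`"). Mechanism over `𝔽₂`: if `ā₁ ≠ 0` the point `(ā₃, f(ā₃))` is rational of exact order `2`, so
`#Ẽ(𝔽₂)` is even and `a₂ = 3 − #Ẽ(𝔽₂)` is odd; and `ā₁ = 0`, `Δ̄ ≠ 0` force `ā₃ = 1` (`Δ̄ = ā₃⁴`).
[folklore; Silverman AEC III.1, V.2, Appendix A]

§2 = ASSEMBLY (this seat): packet C's binder `hsq : N·|Δ| = m²` is DISCHARGED by (26a)
(`Supersingular/TamagawaParitySquare.lean`, `exists_conductorNorm_mul_abs_minimalDiscriminantInt_eq_sq`: `Tam(E)` odd ⇒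
`N_E·|Δ_min| = m²`), `N_E` odd from good reduction at `2` (`N_E ∣ |Δ_min|`, `2 ∤ Δ_min`), so — entirely in tree language —
**`GoodSS W 2` ∧ `Odd W.tamagawaProduct` ⇒ `N_E ≡ 5 (mod 8)` if `Δ_min > 0`, `N_E ≡ 3 (mod 8)` if `Δ_min < 0`, and
`χ₈(N_E) = −1`** (`conductorNorm_emod_eight_of_goodSS_two_of_odd_tamagawaProduct`,
`χ₈_conductorNorm_eq_neg_one_of_goodSS_two_of_odd_tamagawaProduct`); with the tree's twist root-number theorem
`WeierstrassCurve.rootNumber_quadraticTwist_two` (Murty–Murty Ch. 6 §1 / Atkin–Lehner §6, from the Modularity Theorem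
`exists_isNewformOf`, a HYPOTHESIS as everywhere in the tree) this is **`w(E^{(2)}) = −w(E)`**
(`rootNumber_quadraticTwist_two_eq_neg_of_goodSS_two_of_odd_tamagawaProduct`) — lens-1's dictionary row (C159 (ii)):
lens-4's Kurihara habitat (Tam odd, `r = 0`, good ss at 2) sits entirely on the `w₈ = −1` (BV2) side. §3 = lens-4's
R-SGN2 (i) proper (4.36 (a) / 4.42 (iv)): for `Tam(E)` odd and a prime `ℓ ≡ 1 (mod 4)`, `ℓ ∤ N_E`:
`w(E^{(ℓ)}) = (Δ_min | ℓ)·w(E)` (`rootNumber_quadraticTwist_eq_jacobiSym_mul_of_odd_tamagawaProduct`, via the tree's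
`rootNumber_quadraticTwist_of_emod_four_eq_one`: `w(E^{(ℓ)}) = (−1|ℓ)(N_E|ℓ)w(E)`, and `(N_E|ℓ) = (|Δ_min| |ℓ)` because
`N_E·|Δ_min|` is a square prime to `ℓ`), so an ADMISSIBLE `ℓ` (`(Δ_min | ℓ) = −1`, i.e. `Frob_ℓ` odd on `E[2]`) FLIPS the
sign (`rootNumber_quadraticTwist_eq_neg_of_odd_tamagawaProduct`). Census (EVIDENCE, not used): lens-1 50 552 / 50 552
Tam-odd good-ss Cremona curves with `N ≡ ±3 (mod 8)` (sign-refined 18 179 + 32 373), refuter v12 §76 second engine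
0 violations; lens-4 7 152 / 7 152 admissible singles with `w(E^{(ℓ)}) = −w(E)`.

References: J. H. Silverman, AEC (GTM 106) III.1, V.2, VII.5.1, App. A; ATAEC (GTM 151) IV.9 Table 4.1, IV.11.1;
M. R. Murty, V. K. Murty, *Non-vanishing of L-functions and applications* (1997) Ch. 6 §1; A. O. L. Atkin, J. Lehner,
Math. Ann. 185 (1970) §6.
-/

set_option autoImplicit false

noncomputable section

open scoped Classical NumberTheorySymbols

namespace Summit.BirchSwinnertonDyer.Rank1Residual.Supersingular

open WeierstrassCurve

/-! ## §1. LINK LEMMA (lens-1 GEN 9 rider 9a, ported): good supersingular at `2` ⇒ `a₁` even, `a₃` odd, `Δ_min ≡ 5 (mod 8)` -/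

/-! ### §1.0 Over `𝔽₂` -/

/-- Over `𝔽₂`: `a₁ ≠ 0` and `Δ ≠ 0` ⇒ `(a₃, a₃³ + a₂a₃² + a₄a₃ + a₆)` is a rational point of order `2`, so the
number of points (incl. `O`) is even. [folklore] -/
theorem two_dvd_natCard_point_of_a₁_ne_zero (E : WeierstrassCurve (ZMod 2)) (ha : E.a₁ ≠ 0) (hΔ : E.Δ ≠ 0) :
    2 ∣ Nat.card E.toAffine.Point := by
  have ha1 : E.a₁ = 1 := by
    have key : ∀ a : ZMod 2, a ≠ 0 → a = 1 := by decide
    exact key _ ha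
  have heq : E.toAffine.Equation E.a₃ (E.a₃ ^ 3 + E.a₂ * E.a₃ ^ 2 + E.a₄ * E.a₃ + E.a₆) := by
    rw [WeierstrassCurve.Affine.equation_iff]
    have key : ∀ a₂ a₃ a₄ a₆ : ZMod 2,
        (a₃ ^ 3 + a₂ * a₃ ^ 2 + a₄ * a₃ + a₆) ^ 2 + 1 * a₃ * (a₃ ^ 3 + a₂ * a₃ ^ 2 + a₄ * a₃ + a₆)
          + a₃ * (a₃ ^ 3 + a₂ * a₃ ^ 2 + a₄ * a₃ + a₆) = a₃ ^ 3 + a₂ * a₃ ^ 2 + a₄ * a₃ + a₆ := by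
      decide
    simpa [ha1] using key E.a₂ E.a₃ E.a₄ E.a₆
  have hns : E.toAffine.Nonsingular E.a₃ (E.a₃ ^ 3 + E.a₂ * E.a₃ ^ 2 + E.a₄ * E.a₃ + E.a₆) :=
    (WeierstrassCurve.Affine.equation_iff_nonsingular_of_Δ_ne_zero (W := E.toAffine) hΔ).mp heq
  set P : E.toAffine.Point := WeierstrassCurve.Affine.Point.some _ _ hns with hP
  have hneg : -P = P := by
    rw [hP, WeierstrassCurve.Affine.Point.neg_some, WeierstrassCurve.Affine.Point.some.injEq]
    refine ⟨rfl, ?_⟩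
    rw [WeierstrassCurve.Affine.negY, ha1]
    have key : ∀ x y : ZMod 2, -y - 1 * x - x = y := by decide
    exact key _ _
  have hP0 : P ≠ 0 := WeierstrassCurve.Affine.Point.some_ne_zero hns
  have h2P : 2 • P = 0 := by
    rw [two_nsmul]
    nth_rewrite 2 [← hneg]
    exact add_neg_cancel P
  have hord : addOrderOf P = 2 := addOrderOf_eq_prime h2P hP0
  have h := addOrderOf_dvd_natCard P
  rwa [hord] at h

/-- Over `𝔽₂`: `a₁ = 0` and `Δ ≠ 0` ⇒ `a₃ = 1` (`Δ = a₃⁴` when `a₁ = 0`). [folklore] -/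
theorem a₃_eq_one_of_a₁_eq_zero (E : WeierstrassCurve (ZMod 2)) (ha : E.a₁ = 0) (hΔ : E.Δ ≠ 0) : E.a₃ = 1 := by
  have key : ∀ a₁ a₂ a₃ a₄ a₆ : ZMod 2, a₁ = 0 →
      (⟨a₁, a₂, a₃, a₄, a₆⟩ : WeierstrassCurve (ZMod 2)).Δ ≠ 0 → a₃ = 1 := by
    simp only [WeierstrassCurve.Δ, WeierstrassCurve.b₂, WeierstrassCurve.b₄, WeierstrassCurve.b₆,
      WeierstrassCurve.b₈]
    decide
  obtain ⟨a₁, a₂, a₃, a₄, a₆⟩ := E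
  exact key a₁ a₂ a₃ a₄ a₆ ha hΔ

/-! ### §1.1 Integral models -/

/-- **An integral model with `2 ∤ Δ` and an odd number of points mod `2` has `a₁` even and `a₃` odd.** [folklore] -/
theorem even_a₁_and_odd_a₃_of_odd_card (E : WeierstrassCurve ℤ) (hΔ : ¬ (2 : ℤ) ∣ E.Δ)
    (hN : ¬ 2 ∣ Nat.card (E.map (Int.castRingHom (ZMod 2))).toAffine.Point) :
    Even E.a₁ ∧ Odd E.a₃ := by
  set F : WeierstrassCurve (ZMod 2) := E.map (Int.castRingHom (ZMod 2)) with hF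
  have hFΔ : F.Δ ≠ 0 := by
    rw [hF, WeierstrassCurve.map_Δ, eq_intCast]
    rwa [Ne, ZMod.intCast_zmod_eq_zero_iff_dvd]
  have hF1 : F.a₁ = 0 := by
    by_contra h
    exact hN (two_dvd_natCard_point_of_a₁_ne_zero F h hFΔ)
  have hF3 : F.a₃ = 1 := a₃_eq_one_of_a₁_eq_zero F hF1 hFΔ
  have h1 : ((E.a₁ : ℤ) : ZMod 2) = 0 := by simpa [hF] using hF1
  have h3 : ((E.a₃ : ℤ) : ZMod 2) = 1 := by simpa [hF] using hF3
  refine ⟨?_, ?_⟩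
  · exact even_iff_two_dvd.mpr ((ZMod.intCast_zmod_eq_zero_iff_dvd E.a₁ 2).mp h1)
  · have h3' : (((E.a₃ - 1 : ℤ)) : ZMod 2) = 0 := by push_cast; rw [h3]; ring
    obtain ⟨c, hc⟩ := (ZMod.intCast_zmod_eq_zero_iff_dvd (E.a₃ - 1) 2).mp h3'
    exact ⟨c, by omega⟩

/-! ### §1.2 In the tree's language (`GoodSS W 2`) -/

/-- **Good supersingular reduction at `2` ⇒ the global minimal model has `a₁` even and `a₃` odd.**
Inputs: `not_dvd_minimalDiscriminantInt_of_hasGoodReductionAtPrime'` (good ⇒ `2 ∤ Δ_min`) and the definition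
`frobeniusTrace W 2 = 3 − #Ẽ(𝔽₂)`. [folklore] -/
theorem even_a₁_and_odd_a₃_of_goodSS_two (W : WeierstrassCurve ℚ) [W.IsGloballyMinimal]
    (hgood : W.HasGoodReductionAtPrime 2) (hss : (2 : ℤ) ∣ W.frobeniusTrace 2) :
    Even (integralModelInt W).a₁ ∧ Odd (integralModelInt W).a₃ := by
  have hΔ := W.not_dvd_minimalDiscriminantInt_of_hasGoodReductionAtPrime' 2 hgood
  refine even_a₁_and_odd_a₃_of_odd_card (integralModelInt W) (by simpa [minimalDiscriminantInt] using hΔ) ?_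
  intro h2N
  unfold WeierstrassCurve.frobeniusTrace WeierstrassCurve.reductionPointCount at hss
  obtain ⟨c, hc⟩ := h2N
  rw [hc] at hss
  push_cast at hss
  omega

/-- **Good supersingular reduction at `2` ⇒ `Δ_min ≡ 5 (mod 8)`** ("2 is inert in `ℚ(√Δ)`"). [folklore] -/
theorem minimalDiscriminantInt_emod_eight_of_goodSS_two (W : WeierstrassCurve ℚ) [W.IsGloballyMinimal]
    (hgood : W.HasGoodReductionAtPrime 2) (hss : (2 : ℤ) ∣ W.frobeniusTrace 2) :
    minimalDiscriminantInt W % 8 = 5 := by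
  obtain ⟨h1, h3⟩ := even_a₁_and_odd_a₃_of_goodSS_two W hgood hss
  exact Δ_emod_eight (integralModelInt W) h1 h3

/-! ## §2. ASSEMBLY: the dictionary law `N_E ≡ ±3 (mod 8)`, `χ₈(N_E) = −1`, `w(E^{(2)}) = −w(E)` for Tam-odd good-ss rows -/

section Assembly

open NumberField Rat.HeightOneSpectrum Literature.NumberTheory.EllipticCurves.ModularForms

variable (W : WeierstrassCurve ℚ) [W.IsElliptic] [W.IsGloballyMinimal]

/-- **Good reduction at `2` ⇒ `N_E` is odd** (`N_E ∣ |Δ_min|` and `2 ∤ Δ_min`). [folklore] -/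
theorem not_two_dvd_conductorNorm_of_hasGoodReductionAtPrime_two (hgood : W.HasGoodReductionAtPrime 2) :
    ¬ 2 ∣ W.conductorNorm ℤ := by
  intro h2
  have hΔ := W.not_dvd_minimalDiscriminantInt_of_hasGoodReductionAtPrime' 2 hgood
  have hdvd : W.conductorNorm ℤ ∣ (minimalDiscriminantInt W).natAbs := by
    rw [← W.minimalDiscriminantNorm_int_eq_natAbs_minimalDiscriminantInt_holds]
    exact W.conductorNorm_dvd_minimalDiscriminantNorm
      (W.finite_setOf_ordMinimalDiscriminant_ne_zero_holds (A := ℤ))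
  exact hΔ (Int.natCast_dvd.mpr (h2.trans hdvd))

/-- `N_E` odd, as an integer. [folklore] -/
theorem odd_intCast_conductorNorm_of_hasGoodReductionAtPrime_two (hgood : W.HasGoodReductionAtPrime 2) :
    Odd (W.conductorNorm ℤ : ℤ) := by
  rw [Int.odd_coe_nat, Nat.odd_iff]
  have := not_two_dvd_conductorNorm_of_hasGoodReductionAtPrime_two W hgood
  omega

/-- **THE DICTIONARY LAW in tree language: good supersingular at `2` and `Tam(E)` odd ⇒ `N_E ≡ 5 (mod 8)` if
`Δ_min > 0`, `N_E ≡ 3 (mod 8)` if `Δ_min < 0`** (packet C `conductor_emod_eight_of_supersingular_two` ∘ link lemma §1 ∘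
(26a) `exists_conductorNorm_mul_abs_minimalDiscriminantInt_eq_sq`). [folklore] -/
theorem conductorNorm_emod_eight_of_goodSS_two_of_odd_tamagawaProduct (hgood : W.HasGoodReductionAtPrime 2)
    (hss : (2 : ℤ) ∣ W.frobeniusTrace 2) (hodd : Odd W.tamagawaProduct) :
    (0 < minimalDiscriminantInt W → (W.conductorNorm ℤ : ℤ) % 8 = 5) ∧
      (minimalDiscriminantInt W < 0 → (W.conductorNorm ℤ : ℤ) % 8 = 3) := by
  obtain ⟨h1, h3⟩ := even_a₁_and_odd_a₃_of_goodSS_two W hgood hss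
  obtain ⟨m, hm⟩ := exists_conductorNorm_mul_abs_Δ_integralModelInt_eq_sq W hodd
  exact (conductor_emod_eight_of_supersingular_two (integralModelInt W) h1 h3
    (odd_intCast_conductorNorm_of_hasGoodReductionAtPrime_two W hgood) hm).1

/-- **`χ₈(N_E) = −1`** for good supersingular at `2` and `Tam(E)` odd. [folklore] -/
theorem χ₈_conductorNorm_eq_neg_one_of_goodSS_two_of_odd_tamagawaProduct (hgood : W.HasGoodReductionAtPrime 2)
    (hss : (2 : ℤ) ∣ W.frobeniusTrace 2) (hodd : Odd W.tamagawaProduct) :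
    ZMod.χ₈ (W.conductorNorm ℤ) = -1 := by
  obtain ⟨h1, h3⟩ := even_a₁_and_odd_a₃_of_goodSS_two W hgood hss
  obtain ⟨m, hm⟩ := exists_conductorNorm_mul_abs_Δ_integralModelInt_eq_sq W hodd
  have h := (conductor_emod_eight_of_supersingular_two (integralModelInt W) h1 h3
    (odd_intCast_conductorNorm_of_hasGoodReductionAtPrime_two W hgood) hm).2
  rwa [Int.cast_natCast] at h

omit [W.IsElliptic] [W.IsGloballyMinimal] in
/-- Good reduction at the prime `2` in the place-indexed form consumed by the tree's twist root-number theorems. [folklore] -/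
theorem hasGoodReductionAt_of_natGenerator_eq_two (hgood : W.HasGoodReductionAtPrime 2)
    (w : IsDedekindDomain.HeightOneSpectrum (𝓞 ℚ)) (hw : natGenerator w = 2) : W.HasGoodReductionAt w :=
  (hasGoodReductionAtPrime_primesEquiv_iff_holds W w 2 hw).mp hgood

/-- **`w(E^{(2)}) = −w(E)` on Tam-odd good-supersingular-at-2 rows** (the tree's `rootNumber_quadraticTwist_two`:
`w(E^{(2)}) = χ₈(N_E)·w(E)` for `E` good at `2` with odd conductor, from the Modularity Theorem `hmod`; and `χ₈(N_E) = −1`).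
Lens-1's dictionary row (o1 lead C159 (ii)): the Kurihara habitat lies on the `w₈ = −1` side. [cite: MurtyMurty1997, Ch. 6 §1] -/
theorem rootNumber_quadraticTwist_two_eq_neg_of_goodSS_two_of_odd_tamagawaProduct (hmod : exists_isNewformOf)
    (hgood : W.HasGoodReductionAtPrime 2) (hss : (2 : ℤ) ∣ W.frobeniusTrace 2) (hodd : Odd W.tamagawaProduct) :
    (W.quadraticTwist 2).rootNumber = -W.rootNumber := by
  have h := (W.rootNumber_quadraticTwist_two hmod (not_two_dvd_conductorNorm_of_hasGoodReductionAtPrime_two W hgood)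
    (hasGoodReductionAt_of_natGenerator_eq_two W hgood)).1
  rw [h, χ₈_conductorNorm_eq_neg_one_of_goodSS_two_of_odd_tamagawaProduct W hgood hss hodd]
  ring

end Assembly

/-! ## §3. R-SGN2 (i): `Tam(E)` odd ⇒ `w(E^{(ℓ)}) = (Δ_min | ℓ)·w(E)` for primes `ℓ ≡ 1 (mod 4)`, `ℓ ∤ N_E` -/

section SignLemma

open NumberField Literature.NumberTheory.EllipticCurves Literature.NumberTheory.EllipticCurves.ModularForms

variable (W : WeierstrassCurve ℚ) [W.IsElliptic] [W.IsGloballyMinimal]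

/-- `ℓ ∤ N_E` ⇒ `ℓ ∤ Δ_min` for a prime `ℓ` (`N_E` and `Δ_min` have the same prime factors). [folklore] -/
theorem not_dvd_minimalDiscriminantInt_of_not_dvd_conductorNorm {ℓ : ℕ} (hℓ : ℓ.Prime)
    (hℓN : ¬ ℓ ∣ W.conductorNorm ℤ) : ¬ (ℓ : ℤ) ∣ minimalDiscriminantInt W := by
  intro h
  have h' : ℓ ∣ W.minimalDiscriminantNorm ℤ := by
    rw [W.minimalDiscriminantNorm_int_eq_natAbs_minimalDiscriminantInt_holds]
    exact Int.natCast_dvd.mp h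
  have hmem : ℓ ∈ (W.minimalDiscriminantNorm ℤ).primeFactors :=
    Nat.mem_primeFactors.mpr ⟨hℓ, h', (W.minimalDiscriminantNorm_pos_holds).ne'⟩
  rw [← primeFactors_conductorNorm_eq W] at hmem
  exact hℓN (Nat.dvd_of_mem_primeFactors hmem)

/-- **`Tam(E)` odd, `ℓ ∤ N_E` an odd prime ⇒ `(N_E | ℓ) = (|Δ_min| | ℓ)`**: `N_E·|Δ_min| = m²` is prime to `ℓ`, so the
product of the two symbols is `(m² | ℓ) = 1`. [folklore] -/
theorem jacobiSym_conductorNorm_eq_jacobiSym_abs_minimalDiscriminantInt {ℓ : ℕ} (hℓ : ℓ.Prime)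
    (hℓN : ¬ ℓ ∣ W.conductorNorm ℤ) (hodd : Odd W.tamagawaProduct) :
    J((W.conductorNorm ℤ : ℤ) | ℓ) = J(|minimalDiscriminantInt W| | ℓ) := by
  haveI : Fact ℓ.Prime := ⟨hℓ⟩
  obtain ⟨m, hm⟩ := exists_conductorNorm_mul_abs_minimalDiscriminantInt_eq_sq W hodd
  have hΔ := not_dvd_minimalDiscriminantInt_of_not_dvd_conductorNorm W hℓ hℓN
  -- `ℓ ∤ m`
  have hℓm : ¬ ℓ ∣ m.natAbs := by
    intro hdvd
    have hdvd' : (ℓ : ℤ) ∣ m := Int.natCast_dvd.mpr hdvd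
    have hprime : Prime (ℓ : ℤ) := Nat.prime_iff_prime_int.mp hℓ
    have : (ℓ : ℤ) ∣ (W.conductorNorm ℤ : ℤ) * |minimalDiscriminantInt W| := by
      rw [hm, sq]; exact hdvd'.mul_left m
    rcases hprime.dvd_or_dvd this with h | h
    · exact hℓN (Int.natCast_dvd_natCast.mp h)
    · exact hΔ ((dvd_abs _ _).mp h)
  have hm' : Int.gcd m ℓ = 1 := by
    rw [Int.gcd_eq_natAbs, Int.natAbs_natCast]
    exact Nat.coprime_comm.mp ((Nat.Prime.coprime_iff_not_dvd hℓ).mpr hℓm)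
  have hN1 : Int.gcd (W.conductorNorm ℤ : ℤ) ℓ = 1 := by
    rw [Int.gcd_natCast_natCast]
    exact (Nat.coprime_comm.mp ((Nat.Prime.coprime_iff_not_dvd hℓ).mpr hℓN))
  have hprod : J((W.conductorNorm ℤ : ℤ) | ℓ) * J(|minimalDiscriminantInt W| | ℓ) = 1 := by
    rw [← jacobiSym.mul_left, hm, jacobiSym.sq_one' hm']
  rcases jacobiSym.eq_one_or_neg_one hN1 with h | h <;> rw [h] at hprod ⊢
  · simpa using hprod.symm
  · have : J(|minimalDiscriminantInt W| | ℓ) = -1 := by linarith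
    exact this.symm

/-- **R-SGN2 (i) (lens-4 4.36 (a), 4.42 (iv)): `Tam(E)` odd, `ℓ ≡ 1 (mod 4)` prime, `ℓ ∤ N_E` ⇒
`w(E^{(ℓ)}) = (Δ_min | ℓ)·w(E)`** (`= (−1|ℓ)(N_E|ℓ)w(E)` by the tree's `rootNumber_quadraticTwist_of_emod_four_eq_one`,
Murty–Murty Ch. 6 §1, modularity `hmod` a hypothesis; `(−1|ℓ) = 1`; `(N_E|ℓ) = (|Δ_min| |ℓ) = (Δ_min|ℓ)`).
[cite: MurtyMurty1997, Ch. 6 §1] -/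
theorem rootNumber_quadraticTwist_eq_jacobiSym_mul_of_odd_tamagawaProduct (hmod : exists_isNewformOf)
    {ℓ : ℕ} (hℓ : ℓ.Prime) (hℓ4 : ℓ % 4 = 1) (hℓN : ¬ ℓ ∣ W.conductorNorm ℤ) (hodd : Odd W.tamagawaProduct) :
    (W.quadraticTwist (ℓ : ℚ)).rootNumber = J(minimalDiscriminantInt W | ℓ) * W.rootNumber := by
  have hℓodd : Odd ℓ := Nat.odd_iff.mpr (by omega)
  have hD4 : (ℓ : ℤ) % 4 = 1 := by exact_mod_cast hℓ4
  have hsq : Squarefree (ℓ : ℤ) := by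
    rw [Int.squarefree_natCast]
    exact hℓ.squarefree
  have hgcd : Int.gcd (ℓ : ℤ) (W.conductorNorm ℤ) = 1 := by
    rw [Int.gcd_natCast_natCast]
    exact (Nat.Prime.coprime_iff_not_dvd hℓ).mpr hℓN
  have h := (W.rootNumber_quadraticTwist_of_emod_four_eq_one hmod hD4 hsq hgcd).1
  have hcast : ((ℓ : ℤ) : ℚ) = (ℓ : ℚ) := by push_cast; rfl
  rw [hcast] at h
  rw [h, Int.natAbs_natCast, jacobiSym.at_neg_one hℓodd, ZMod.χ₄_nat_one_mod_four hℓ4, one_mul,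
    jacobiSym_conductorNorm_eq_jacobiSym_abs_minimalDiscriminantInt W hℓ hℓN hodd]
  rcases le_or_gt 0 (minimalDiscriminantInt W) with hpos | hneg
  · rw [abs_of_nonneg hpos]
  · rw [abs_of_neg hneg, jacobiSym.neg _ hℓodd, ZMod.χ₄_nat_one_mod_four hℓ4, one_mul]

/-- **An admissible prime flips the sign**: `Tam(E)` odd, `ℓ ≡ 1 (mod 4)`, `ℓ ∤ N_E`, `(Δ_min | ℓ) = −1` (i.e. `Frob_ℓ`
acts as an odd permutation on the roots of the 2-division cubic) ⇒ `w(E^{(ℓ)}) = −w(E)`; census 7 152 / 7 152 (lens-4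
KUR2H-v1, EVIDENCE). [cite: MurtyMurty1997, Ch. 6 §1] -/
theorem rootNumber_quadraticTwist_eq_neg_of_odd_tamagawaProduct (hmod : exists_isNewformOf)
    {ℓ : ℕ} (hℓ : ℓ.Prime) (hℓ4 : ℓ % 4 = 1) (hℓN : ¬ ℓ ∣ W.conductorNorm ℤ) (hodd : Odd W.tamagawaProduct)
    (hadm : J(minimalDiscriminantInt W | ℓ) = -1) :
    (W.quadraticTwist (ℓ : ℚ)).rootNumber = -W.rootNumber := by
  rw [rootNumber_quadraticTwist_eq_jacobiSym_mul_of_odd_tamagawaProduct W hmod hℓ hℓ4 hℓN hodd, hadm]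
  ring

end SignLemma

/-! ## §4. The same laws bundled over the tree's class predicate `GoodSS W 2` (o1 typer item (26c))

`Literature.NumberTheory.EllipticCurves.Rank1Residual.GoodSS W 2 := W.HasGoodReductionAtPrime 2 ∧ 2 ∣ a₂(W)` is the
cell's class predicate (O1-B(ss)); the statements of §1.2 / §2 take its two conjuncts separately.  This section is the
one-line re-bundling asked for as typer item (26c) (lens-4 4.48 R-SGN2⁺ (iii′): `Odd Tam(W) → GoodSS W 2 →
N_E % 8 ∈ {3, 5}`; o1 lead C161 (e) / C170 (c)), with the sign split of `Δ_min` discharged by `Δ_min ≠ 0`.  Nothing new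
is asserted; composition only. -/

section GoodSSBundled

open Literature.NumberTheory.EllipticCurves.Rank1Residual Literature.NumberTheory.EllipticCurves.ModularForms

variable (W : WeierstrassCurve ℚ) [W.IsElliptic] [W.IsGloballyMinimal]

omit [W.IsElliptic] in
/-- `GoodSS W 2 ⇒ Δ_min ≡ 5 (mod 8)` (bundled form of `minimalDiscriminantInt_emod_eight_of_goodSS_two`; lens-4 G7-Δ (ii),
census 226 175 / 226 175, EVIDENCE not used). [folklore] -/
theorem minimalDiscriminantInt_emod_eight_eq_five_of_goodSS_two (h : GoodSS W 2) :
    minimalDiscriminantInt W % 8 = 5 :=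
  minimalDiscriminantInt_emod_eight_of_goodSS_two W h.1 h.2

/-- **(26c) = lens-4 G7-Δ (iii′) in the tree's class vocabulary: `GoodSS W 2 ∧ Odd Tam(W) ⇒ N_E ≡ 3 or 5 (mod 8)`**
(`= 5` iff `Δ_min > 0`, `= 3` iff `Δ_min < 0`, by `conductorNorm_emod_eight_of_goodSS_two_of_odd_tamagawaProduct` and
`Δ_min ≠ 0`). [folklore] -/
theorem conductorNorm_emod_eight_eq_three_or_eq_five_of_goodSS_two (h : GoodSS W 2) (hodd : Odd W.tamagawaProduct) :
    (W.conductorNorm ℤ : ℤ) % 8 = 3 ∨ (W.conductorNorm ℤ : ℤ) % 8 = 5 := by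
  obtain ⟨h5, h3⟩ := conductorNorm_emod_eight_of_goodSS_two_of_odd_tamagawaProduct W h.1 h.2 hodd
  rcases lt_or_gt_of_ne (minimalDiscriminantInt_ne_zero W) with hneg | hpos
  · exact Or.inl (h3 hneg)
  · exact Or.inr (h5 hpos)

/-- `GoodSS W 2 ∧ Odd Tam(W) ⇒ χ₈(N_E) = −1` (bundled form). [folklore] -/
theorem χ₈_conductorNorm_eq_neg_one_of_goodSS_two (h : GoodSS W 2) (hodd : Odd W.tamagawaProduct) :
    ZMod.χ₈ (W.conductorNorm ℤ) = -1 :=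
  χ₈_conductorNorm_eq_neg_one_of_goodSS_two_of_odd_tamagawaProduct W h.1 h.2 hodd

/-- `GoodSS W 2 ∧ Odd Tam(W) ⇒ w(E^{(2)}) = −w(E)` (bundled form; modularity `hmod` as hypothesis): the lens-4
Kurihara habitat (O1-B(ss) ∧ Tam odd) lies on lens-1's `w₈ = −1` side (o1 lead C159 (ii) / C170 (a)).
[cite: MurtyMurty1997, Ch. 6 §1] -/
theorem rootNumber_quadraticTwist_two_eq_neg_of_goodSS_two (hmod : exists_isNewformOf) (h : GoodSS W 2)
    (hodd : Odd W.tamagawaProduct) : (W.quadraticTwist 2).rootNumber = -W.rootNumber :=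
  rootNumber_quadraticTwist_two_eq_neg_of_goodSS_two_of_odd_tamagawaProduct W hmod h.1 h.2 hodd

end GoodSSBundled

end Summit.BirchSwinnertonDyer.Rank1Residual.Supersingular

end
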